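import Summits.AtomisticToContinuum.FouriersLaw.Theorems.OddSectorIrreversibilityResponseDensityResponseIdentity
import Summits.AtomisticToContinuum.FouriersLaw.Theorems.OddSectorIrreversibilityResponseDensityKernelContinuity
import Summits.AtomisticToContinuum.FouriersLaw.Theorems.OddSectorIrreversibilityCorrectorTheorySmooth
import Summits.AtomisticToContinuum.FouriersLaw.Theorems.OddSectorIrreversibilityOddDensityIsCorrectorMainPrep
import Mathlib.MeasureTheory.Integral.ExpDecay

/-!
# `OpenChainGreenKubo` (stmt-AtomisticToContinuum-12696): the continuity hypothesis (CONT) from a UNIFORM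
# exponential relaxation of the current forecast near equilibrium

Helper file (`--supports`) for the support item `HonestZwanzig.OpenChainGreenKubo`. After ★ (`…Star.lean`) and the
KDN identity (`…KDN.lean`) the item is reduced (`openChainGreenKubo_of_star_of_cont_of_kdn`) to the continuity at
`δ = 0` of the NESS-kernel pairing `I(δ) = ∫₀^∞ ∫ g · (P^{T+δ/2,T-δ/2}_s J) dμ_T ds` (`g = (γ/2)(p_0² - p_{N-1}²)`,
`J = Σ_i j_i`). This file isolates the one dynamical input that remains: if the forecast of the total current relaxes
exponentially, UNIFORMLY for bath temperatures near `(T, T)` —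

  (UH) `∃ δ₀, ϑ, C, c > 0` (`ϑ < 1/T`): for `|δ| ≤ δ₀` there is `m_δ` with `|P^{T+δ/2,T-δ/2}_t J(z) - m_δ| ≤ C e^{ϑH(z)} e^{-ct}`
  for all `z`, `t ≥ 0`

(CEHR 2018 (2.5) gives this at each FIXED `δ` with `m_δ = μ_δ(J)`; the uniformity of `C, c` in `δ` is the content) — then
(CONT) holds (`tendsto_pairing_of_uniform_decay`): pointwise continuity in `δ` of the forecasts
(`pinnedChain_tendsto_integral_kernel_temps`, proved in the tree), `μ_T(g) = 0`, and dominated convergence in `x`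
(CEHR (3.4), uniform since `T_L + T_R = 2T` along the family) and in `s` (the uniform majorant `K e^{-cs}`).
No definitions.
-/

noncomputable section

open MeasureTheory ProbabilityTheory Filter Topology Set
open scoped NNReal ENNReal ContDiff BigOperators

namespace Summit.AtomisticToContinuum.FouriersLaw.Theorems.OpenChainGreenKubo

open Literature.MathematicalPhysics.KineticTheory.HeatConduction
open Literature.MathematicalPhysics.KineticTheory OscillatorChain
open Summit.AtomisticToContinuum.FouriersLaw.Theorems.OddSectorIrreversibility.Corrector

variable {N : ℕ}

/-- The pairing of the KDN source `g = (γ/2)(p_0² - p_{N-1}²)` with any `w` under the Gibbs measure is `Z⁻¹ (γ/2)` times the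
Lebesgue odd-moment pairing `∫ w e^{-H/T}(p_0² - p_{N-1}²) dx` (`Z = ∫ e^{-H/T} dx`). [folklore] -/
theorem integral_source_mul_eq (P : OscillatorChain) (hN : 2 ≤ N) (γ' T : ℝ) (w : PhaseSpace N → ℝ) :
    ∫ x, γ' / 2 * (x.2 ⟨0, by omega⟩ ^ 2 - x.2 ⟨N - 1, by omega⟩ ^ 2) * w x ∂(P.gibbsMeasure N T) =
      (∫ x, Real.exp (-1 / T * P.hamiltonian N x))⁻¹ *
        (γ' / 2 * ∫ x, w x * (Real.exp (-1 / T * P.hamiltonian N x) *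
          (x.2 ⟨0, by omega⟩ ^ 2 - x.2 ⟨N - 1, by omega⟩ ^ 2))) := by
  have hρ : ∀ x, P.gibbsDensity N T x = Real.exp (-1 / T * P.hamiltonian N x) := fun x => by
    unfold OscillatorChain.gibbsDensity; congr 1; ring
  rw [P.integral_gibbsMeasure]
  simp only [hρ]
  congr 1
  rw [← integral_const_mul]
  refine integral_congr_ae (Eventually.of_forall fun x => ?_)
  ring

section Cont

variable {ω₂ lam β γ : ℝ} (hω : 0 < ω₂) (hl : 0 < lam) (hβ : 0 < β) (hγ : 0 < γ) (hN : 2 ≤ N)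
  {T : ℝ} (hT : 0 < T)
include hω hl hβ hγ hN hT

/-- `μ_T(g · 1) = 0`: the KDN source has zero Gibbs mean (the odd Gibbs moment vanishes,
`integral_gibbsWeight_oddMoment_eq_zero`). [folklore] -/
theorem integral_source_gibbsMeasure :
    ∫ x, γ / 2 * (x.2 ⟨0, by omega⟩ ^ 2 - x.2 ⟨N - 1, by omega⟩ ^ 2) * (fun _ => (1 : ℝ)) x
      ∂((pinnedChain ω₂ lam β γ).gibbsMeasure N T) = 0 := by
  have hN0 : 0 < N := by omega
  have hTL : 0 < T + T / 2 := by linarith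
  have hTR : 0 < T - T / 2 := by linarith
  have hmax : 0 < 1 / max (T + T / 2) (T - T / 2) := by positivity
  have h0 := integral_gibbsWeight_oddMoment_eq_zero hω hl.le hβ.le hγ hN0 hT hTL hTR (half_pos hmax)
    (half_lt_self hmax) hT.ne'
  rw [integral_source_mul_eq (pinnedChain ω₂ lam β γ) hN γ T]
  simp only [one_mul]
  rw [h0, mul_zero, mul_zero]

/-- **(CONT) from a uniform exponential relaxation of the current forecast (UH).** If for some `δ₀, ϑ, C, c > 0`
(`ϑ < 1/T`) and every `|δ| ≤ δ₀` the forecast of `J` under the kernels at `(T+δ/2, T-δ/2)` satisfies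
`|P^δ_t J(z) - m_δ| ≤ C e^{ϑH(z)} e^{-ct}` for some constant `m_δ`, then
`δ ↦ ∫₀^∞ ∫ g (P^δ_s J) dμ_T ds` is continuous at `0` along `δ ≠ 0` (indeed along `δ → 0`).
[cite: CuneoEckmannHairerReyBellet2018, Thm 2.13 eq. (2.5)] -/
theorem tendsto_pairing_of_uniform_decay
    (hUH : ∃ δ₀ ϑ C c : ℝ, 0 < δ₀ ∧ 0 < ϑ ∧ ϑ < 1 / T ∧ 0 < c ∧ ∀ δ : ℝ, |δ| ≤ δ₀ → ∃ m : ℝ,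
      ∀ (z : PhaseSpace N) (t : ℝ≥0),
        |(∫ y, (∑ i : Fin N, (pinnedChain ω₂ lam β γ).bondCurrent N i y)
            ∂((pinnedChain ω₂ lam β γ).transitionKernel N (T + δ / 2) (T - δ / 2) t z)) - m| ≤
          C * Real.exp (ϑ * (pinnedChain ω₂ lam β γ).hamiltonian N z) * Real.exp (-c * t)) :
    Tendsto (fun δ : ℝ => ∫ s in Ioi (0 : ℝ), ∫ x,
        γ / 2 * (x.2 ⟨0, by omega⟩ ^ 2 - x.2 ⟨N - 1, by omega⟩ ^ 2) *
          (∫ y, (∑ i : Fin N, (pinnedChain ω₂ lam β γ).bondCurrent N i y)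
            ∂((pinnedChain ω₂ lam β γ).transitionKernel N (T + δ / 2) (T - δ / 2) s.toNNReal x))
        ∂((pinnedChain ω₂ lam β γ).gibbsMeasure N T))
      (𝓝[≠] 0)
      (𝓝 (∫ s in Ioi (0 : ℝ), ∫ x,
        γ / 2 * (x.2 ⟨0, by omega⟩ ^ 2 - x.2 ⟨N - 1, by omega⟩ ^ 2) *
          (∫ y, (∑ i : Fin N, (pinnedChain ω₂ lam β γ).bondCurrent N i y)
            ∂((pinnedChain ω₂ lam β γ).transitionKernel N T T s.toNNReal x))
        ∂((pinnedChain ω₂ lam β γ).gibbsMeasure N T))) := by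
  obtain ⟨δ₀, ϑ, C, c, hδ₀, hϑ, hϑT, hc, hU⟩ := hUH
  set P := pinnedChain ω₂ lam β γ with hP
  set μ := P.gibbsMeasure N T with hμ
  have hN0 : 0 < N := by omega
  haveI : IsProbabilityMeasure μ := pinnedChain_isProbabilityMeasure_gibbsMeasure hω hl.le hβ.le γ N hT
  set J : PhaseSpace N → ℝ := fun y => ∑ i : Fin N, P.bondCurrent N i y with hJ
  set gK : PhaseSpace N → ℝ := fun x => γ / 2 * (x.2 ⟨0, by omega⟩ ^ 2 - x.2 ⟨N - 1, by omega⟩ ^ 2) with hgK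
  have hJc : Continuous J := continuous_totalBondCurrent ω₂ lam β γ N
  have hJ2 : ContDiff ℝ 2 J := (contDiff_totalBondCurrent ω₂ lam β γ N).of_le (by norm_cast)
  have hgc : Continuous gK := continuous_const.mul
    ((((continuous_apply _).comp continuous_snd).pow 2).sub (((continuous_apply _).comp continuous_snd).pow 2))
  have hC0 : 0 ≤ C := by
    obtain ⟨m, hm⟩ := hU 0 (by rw [abs_zero]; exact hδ₀.le)
    have h := hm 0 0
    have : 0 ≤ C * Real.exp (ϑ * P.hamiltonian N 0) * Real.exp (-c * ((0 : ℝ≥0) : ℝ)) := (abs_nonneg _).trans h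
    have h2 : 0 < Real.exp (ϑ * P.hamiltonian N 0) * Real.exp (-c * ((0 : ℝ≥0) : ℝ)) := by positivity
    nlinarith
  -- a small exponent for the current and the source
  set ϑ₂ : ℝ := min (1 / T / 4) ((1 / T - ϑ) / 2) with hϑ₂
  have hT1 : 0 < 1 / T := by positivity
  have hϑ₂0 : 0 < ϑ₂ := lt_min (by positivity) (by linarith)
  have hϑ₂1 : ϑ₂ ≤ 1 / T / 4 := min_le_left _ _
  have hϑ₂2 : ϑ₂ ≤ (1 / T - ϑ) / 2 := min_le_right _ _
  have h2ϑ₂ : 2 * ϑ₂ < 1 / T := by linarith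
  have hsum : ϑ + ϑ₂ < 1 / T := by linarith
  obtain ⟨M, hM0, hJM⟩ := abs_totalBondCurrent_le_exp hω.le hl.le hβ.le γ N hϑ₂0
  obtain ⟨Cg, hCg0, hgb⟩ : ∃ Cg : ℝ, 0 ≤ Cg ∧ ∀ y, |gK y| ≤ Cg * Real.exp (ϑ₂ * P.hamiltonian N y) := by
    refine ⟨|γ| / 1 ^ 2 * (2 * Real.exp ϑ₂ / ϑ₂ ^ 2), by positivity, fun y => ?_⟩
    have h := OddSectorIrreversibility.pinnedChain_abs_mclennanSource_le hω hl.le hβ.le N (γ := γ) (T := 1) hϑ₂0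
      ⟨0, by omega⟩ ⟨N - 1, by omega⟩ y
    have e : γ / (2 * (1 : ℝ) ^ 2) = γ / 2 := by norm_num
    rw [e] at h
    exact h
  -- integrable weights
  have hexpsum := pinnedChain_integrable_exp_mul_hamiltonian_gibbsMeasure hω hl.le hβ.le γ N hT hsum
  have hexp2 := pinnedChain_integrable_exp_mul_hamiltonian_gibbsMeasure hω hl.le hβ.le γ N hT h2ϑ₂
  have hHc : Continuous (P.hamiltonian N) := (pinnedChain_contDiff_hamiltonian ω₂ lam β γ N (n := 0)).continuous
  have hgexp : Integrable (fun x => |gK x| * Real.exp (ϑ * P.hamiltonian N x)) μ := by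
    refine (hexpsum.const_mul Cg).mono'
      (hgc.abs.mul (Real.continuous_exp.comp (continuous_const.mul hHc))).aestronglyMeasurable
      (Eventually.of_forall fun x => ?_)
    rw [Real.norm_eq_abs, abs_mul, abs_abs, abs_of_pos (Real.exp_pos _), add_mul, Real.exp_add]
    calc |gK x| * Real.exp (ϑ * P.hamiltonian N x) ≤ Cg * Real.exp (ϑ₂ * P.hamiltonian N x) * Real.exp (ϑ * P.hamiltonian N x) :=
        mul_le_mul_of_nonneg_right (hgb x) (Real.exp_pos _).le
      _ = Cg * (Real.exp (ϑ * P.hamiltonian N x) * Real.exp (ϑ₂ * P.hamiltonian N x)) := by ring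
  have hgint : Integrable gK μ := by
    refine (hexp2.const_mul Cg).mono' hgc.aestronglyMeasurable (Eventually.of_forall fun x => ?_)
    rw [Real.norm_eq_abs]
    refine (hgb x).trans (mul_le_mul_of_nonneg_left (Real.exp_le_exp.2 ?_) hCg0)
    have := pinnedChain_hamiltonian_nonneg hω.le hl.le hβ.le γ N x
    nlinarith
  -- `μ_T(g) = 0`
  have hg0 : ∫ x, gK x ∂μ = 0 := by
    have h := integral_source_gibbsMeasure hω hl hβ hγ hN hT
    simp only [mul_one] at h
    exact h
  -- the pairings `k δ s`
  set k : ℝ → ℝ → ℝ := fun δ s => ∫ x, gK x *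
    (∫ y, J y ∂(P.transitionKernel N (T + δ / 2) (T - δ / 2) s.toNNReal x)) ∂μ with hk
  -- (b) the uniform majorant
  set K₀ : ℝ := C * ∫ x, |gK x| * Real.exp (ϑ * P.hamiltonian N x) ∂μ with hK₀
  have hdom : ∀ δ : ℝ, |δ| ≤ δ₀ → ∀ s : ℝ, 0 < s → |k δ s| ≤ K₀ * Real.exp (-c * s) := by
    intro δ hδ s hs
    obtain ⟨m, hm⟩ := hU δ hδ
    have hfm : Measurable fun x => ∫ y, J y ∂(P.transitionKernel N (T + δ / 2) (T - δ / 2) s.toNNReal x) :=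
      pinnedChain_measurable_integral_kernel N _ _ hJc.stronglyMeasurable _
    have hmeas : AEStronglyMeasurable (fun x => gK x *
        ∫ y, J y ∂(P.transitionKernel N (T + δ / 2) (T - δ / 2) s.toNNReal x)) μ :=
      (hgc.aestronglyMeasurable).mul hfm.aestronglyMeasurable
    have hbd : ∀ x, |gK x * ((∫ y, J y ∂(P.transitionKernel N (T + δ / 2) (T - δ / 2) s.toNNReal x)) - m)| ≤
        C * Real.exp (-c * s) * (|gK x| * Real.exp (ϑ * P.hamiltonian N x)) := fun x => by
      rw [abs_mul]
      have h := hm x s.toNNReal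
      rw [Real.coe_toNNReal _ hs.le] at h
      calc |gK x| * |(∫ y, J y ∂(P.transitionKernel N (T + δ / 2) (T - δ / 2) s.toNNReal x)) - m|
          ≤ |gK x| * (C * Real.exp (ϑ * P.hamiltonian N x) * Real.exp (-c * s)) :=
            mul_le_mul_of_nonneg_left h (abs_nonneg _)
        _ = _ := by ring
    have hint1 : Integrable (fun x => gK x *
        ((∫ y, J y ∂(P.transitionKernel N (T + δ / 2) (T - δ / 2) s.toNNReal x)) - m)) μ :=
      ((hgexp.const_mul (C * Real.exp (-c * s))).mono'
        (hgc.aestronglyMeasurable.mul (hfm.aestronglyMeasurable.sub aestronglyMeasurable_const))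
        (Eventually.of_forall fun x => by rw [Real.norm_eq_abs]; exact hbd x))
    have hsplit : k δ s = ∫ x, gK x *
        ((∫ y, J y ∂(P.transitionKernel N (T + δ / 2) (T - δ / 2) s.toNNReal x)) - m) ∂μ := by
      have e : (fun x => gK x * ((∫ y, J y ∂(P.transitionKernel N (T + δ / 2) (T - δ / 2) s.toNNReal x)) - m)) =
          fun x => gK x * (∫ y, J y ∂(P.transitionKernel N (T + δ / 2) (T - δ / 2) s.toNNReal x)) - m * gK x := by
        funext x; ring
      have hint0 : Integrable (fun x => gK x *
          (∫ y, J y ∂(P.transitionKernel N (T + δ / 2) (T - δ / 2) s.toNNReal x))) μ := by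
        have := hint1.add ((hgint.const_mul m))
        refine this.congr (Eventually.of_forall fun x => ?_)
        simp only [Pi.add_apply]; ring
      rw [hk]; simp only
      rw [e, integral_sub hint0 (hgint.const_mul m), integral_const_mul, hg0, mul_zero, sub_zero]
    rw [hsplit]
    calc |∫ x, gK x * ((∫ y, J y ∂(P.transitionKernel N (T + δ / 2) (T - δ / 2) s.toNNReal x)) - m) ∂μ|
        ≤ ∫ x, |gK x * ((∫ y, J y ∂(P.transitionKernel N (T + δ / 2) (T - δ / 2) s.toNNReal x)) - m)| ∂μ :=
          abs_integral_le_integral_abs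
      _ ≤ ∫ x, C * Real.exp (-c * s) * (|gK x| * Real.exp (ϑ * P.hamiltonian N x)) ∂μ :=
          integral_mono_of_nonneg (Eventually.of_forall fun x => abs_nonneg _) (hgexp.const_mul _) (Eventually.of_forall hbd)
      _ = K₀ * Real.exp (-c * s) := by rw [integral_const_mul, hK₀]; ring
  -- (c) pointwise continuity in `δ` at every `s`
  have hpt : ∀ s : ℝ, Tendsto (fun δ => k δ s) (𝓝 0) (𝓝 (∫ x, gK x *
      (∫ y, J y ∂(P.transitionKernel N T T s.toNNReal x)) ∂μ)) := by
    intro s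
    have hϑ₂' : ∀ δ : ℝ, |δ| < T → ϑ₂ < 1 / max (T + δ / 2) (T - δ / 2) := by
      intro δ hδ
      have hδ' := abs_lt.1 hδ
      have hm : max (T + δ / 2) (T - δ / 2) < 2 * T := max_lt (by linarith) (by linarith)
      have hmpos : 0 < max (T + δ / 2) (T - δ / 2) := lt_max_of_lt_left (by linarith)
      have h14 : 1 / T / 4 < 1 / (2 * T) := by
        rw [div_div]
        exact one_div_lt_one_div_of_lt (by positivity) (by linarith)
      calc ϑ₂ ≤ 1 / T / 4 := hϑ₂1
        _ < 1 / (2 * T) := h14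
        _ ≤ 1 / max (T + δ / 2) (T - δ / 2) := one_div_le_one_div_of_le hmpos hm.le
    refine tendsto_integral_filter_of_dominated_convergence
      (fun x => |gK x| * (M * (Real.exp (ϑ₂ * γ * (2 * T) * s.toNNReal) * Real.exp (ϑ₂ * P.hamiltonian N x)))) ?_ ?_ ?_ ?_
    · refine Eventually.of_forall fun δ => ?_
      have hfm : Measurable fun x => ∫ y, J y ∂(P.transitionKernel N (T + δ / 2) (T - δ / 2) s.toNNReal x) :=
        pinnedChain_measurable_integral_kernel N _ _ hJc.stronglyMeasurable _
      exact (hgc.aestronglyMeasurable).mul hfm.aestronglyMeasurable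
    · have hball : ∀ᶠ δ : ℝ in 𝓝 0, |δ| < T := by
        have : ∀ᶠ δ : ℝ in 𝓝 0, δ ∈ Ioo (-T) T := Ioo_mem_nhds (by linarith) hT
        filter_upwards [this] with δ hδ using abs_lt.2 ⟨hδ.1, hδ.2⟩
      filter_upwards [hball] with δ hδ
      have hδ' := abs_lt.1 hδ
      have hTL : 0 < T + δ / 2 := by linarith
      have hTR : 0 < T - δ / 2 := by linarith
      refine Eventually.of_forall fun x => ?_
      rw [Real.norm_eq_abs, abs_mul]
      refine mul_le_mul_of_nonneg_left ?_ (abs_nonneg _)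
      have h := pinnedChain_abs_integral_kernel_le' hω hl.le hβ.le hγ hN0 hTL hTR hϑ₂0 (hϑ₂' δ hδ) hJM s.toNNReal x
      have e : T + δ / 2 + (T - δ / 2) = 2 * T := by ring
      rw [e] at h
      exact h
    · exact ((hexp2.const_mul (Cg * (M * Real.exp (ϑ₂ * γ * (2 * T) * s.toNNReal)))).mono'
        (hgc.abs.mul (continuous_const.mul (continuous_const.mul
          (Real.continuous_exp.comp (continuous_const.mul hHc))))).aestronglyMeasurable
        (Eventually.of_forall fun x => by
          rw [Real.norm_eq_abs, abs_mul, abs_abs,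
            abs_of_nonneg (by positivity : (0 : ℝ) ≤ M * (Real.exp (ϑ₂ * γ * (2 * T) * s.toNNReal) *
              Real.exp (ϑ₂ * P.hamiltonian N x))),
            show 2 * ϑ₂ * P.hamiltonian N x = ϑ₂ * P.hamiltonian N x + ϑ₂ * P.hamiltonian N x by ring, Real.exp_add]
          calc |gK x| * (M * (Real.exp (ϑ₂ * γ * (2 * T) * s.toNNReal) * Real.exp (ϑ₂ * P.hamiltonian N x)))
              ≤ Cg * Real.exp (ϑ₂ * P.hamiltonian N x) *
                (M * (Real.exp (ϑ₂ * γ * (2 * T) * s.toNNReal) * Real.exp (ϑ₂ * P.hamiltonian N x))) :=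
                mul_le_mul_of_nonneg_right (hgb x) (by positivity)
            _ = _ := by ring))
    · exact Eventually.of_forall fun x =>
        (pinnedChain_tendsto_integral_kernel_temps hω hl.le hβ.le hγ hN0 hT hϑ₂0 h2ϑ₂ hJc hJM s.toNNReal x).const_mul _
  -- (d) dominated convergence in `s`
  have hmeas : ∀ δ : ℝ, AEStronglyMeasurable (k δ) (volume.restrict (Ioi (0 : ℝ))) := by
    intro δ
    have hm := measurable_oddMoment_pairing hω hl.le hβ.le hγ hN0 (T := T) (δ := δ) hJ2
    have e : k δ = fun s => (∫ x, Real.exp (-1 / T * P.hamiltonian N x))⁻¹ * (γ / 2 *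
        ∫ x, (∫ y, J y ∂(P.transitionKernel N (T + δ / 2) (T - δ / 2) s.toNNReal x)) *
          (Real.exp (-1 / T * P.hamiltonian N x) * (x.2 ⟨0, hN0⟩ ^ 2 - x.2 ⟨N - 1, by omega⟩ ^ 2))) := by
      funext s
      rw [hk]
      exact integral_source_mul_eq P hN γ T _
    rw [e]
    exact ((hm.const_mul _).const_mul _).aestronglyMeasurable
  have hev : ∀ᶠ δ : ℝ in 𝓝[≠] (0 : ℝ), |δ| ≤ δ₀ := by
    have : ∀ᶠ δ : ℝ in 𝓝 0, δ ∈ Icc (-δ₀) δ₀ := Icc_mem_nhds (by linarith) hδ₀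
    exact mem_nhdsWithin_of_mem_nhds (this.mono fun δ hδ => abs_le.2 ⟨hδ.1, hδ.2⟩)
  have hlim := tendsto_integral_filter_of_dominated_convergence (μ := volume.restrict (Ioi (0 : ℝ)))
    (l := 𝓝[≠] (0 : ℝ)) (F := fun δ s => k δ s) (fun s => K₀ * Real.exp (-c * s))
    (Eventually.of_forall hmeas)
    (hev.mono fun δ hδ => (ae_restrict_iff' measurableSet_Ioi).2 (Eventually.of_forall fun s hs => by
      rw [Real.norm_eq_abs]; exact hdom δ hδ s hs))
    ((exp_neg_integrableOn_Ioi 0 hc).const_mul K₀)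
    (Eventually.of_forall fun s => (hpt s).mono_left nhdsWithin_le_nhds)
  exact hlim

end Cont

end Summit.AtomisticToContinuum.FouriersLaw.Theorems.OpenChainGreenKubo

end
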